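import Mathlib
import HarnessLib
import Summits.ValiantsHypothesis.ValiantsHypothesis.Theses.MonotoneRestoration
import Literature.Computability.AlgebraicComplexity.ArithCircuit
import Literature.Computability.AlgebraicComplexity.ArithCircuitProofs
import Literature.Computability.AlgebraicComplexity.MonotoneStructure
import Literature.Computability.AlgebraicComplexity.PermanentIrreducible
import Literature.ModelTheory.FiniteModelTheory.CkEquiv
import Summits.ValiantsHypothesis.ValiantsHypothesis.Theorems.MonotoneRestorationMonotoneRestorationQPCosetCount
import Summits.ValiantsHypothesis.ValiantsHypothesis.Theorems.MonotoneRestorationMonotoneRestorationQPSymmetricLB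
import Summits.ValiantsHypothesis.ValiantsHypothesis.Theorems.MonotoneRestorationMonotoneRestorationQPSupportSymmetrisation
import Summits.ValiantsHypothesis.ValiantsHypothesis.Theorems.MonotoneRestorationMonotoneRestorationQPSparseRegime
import Summits.ValiantsHypothesis.ValiantsHypothesis.Theorems.MonotoneRestorationMonotoneRestorationQPBeta
import Literature.Computability.AlgebraicComplexity.SymmetricArithCircuit
import Literature.Computability.AlgebraicComplexity.DawarWilsenach2025Proofs
import Literature.GroupTheory.PermutationGroups.SmallIndexSubgroups
import Summits.ValiantsHypothesis.ValiantsHypothesis.Theorems.MonotoneRestorationQP.Negative.LoadBearing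
import Summits.ValiantsHypothesis.ValiantsHypothesis.Theorems.MonotoneRestorationMonotoneRestorationQPPermSupportCount

/-! TTRL-lite variant V19930 of stmt-ValiantsHypothesis-15886 -/

-- `Summit.ValiantsHypothesis.ValiantsHypothesis.…` is the tree's mandated single-conjunct layout
-- (Sub = Summit), so the duplicated namespace component is intended.
set_option linter.dupNamespace false

namespace Summit.ValiantsHypothesis.ValiantsHypothesis.Theorems

open Summit.ValiantsHypothesis.ValiantsHypothesis.Theses.MonotoneRestoration
open Literature.Computability.AlgebraicComplexity

/-- Base-case size bound for the explicit threshold in `stub_gammaArithmetic`: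
`4c² + c + 8 ≤ 2^(c+3)` for every natural `c` (TTRL-lite variant V19930).
Proof: induction on `c`; after peeling `c = 0` the step
`4(m+2)² + (m+2) + 8 ≤ 2 · (4(m+1)² + (m+1) + 8)` is the polynomial inequality
`4m² + 17m + 26 ≤ 8m² + 18m + 26`. -/
theorem stub_gammaArithmetic_var19930 : ∀ (c : ℕ), 4 * c * c + c + 8 ≤ 2 ^ (c + 3) := by
  intro c
  induction c with
  | zero => norm_num
  | succ n ih =>
    cases n with
    | zero => norm_num
    | succ m =>
      have h : 2 ^ (m + 1 + 1 + 3) = 2 * 2 ^ (m + 1 + 3) := by ring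
      rw [h]
      nlinarith [ih, Nat.zero_le m]

end Summit.ValiantsHypothesis.ValiantsHypothesis.Theorems
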